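import Summits.ResolutionOfSingularities.ResolutionOfSingularities.Theorems.DeltaCutMirror3
import HarnessLib

/-!
# DeltaCutSingCertificates2 — tree file 6/6 of the decomp-res lens-6 g30 node «SingCut» (HOME `decomp-res-lens-6/g30/SingCut.lean` + `SingCutCertificates.lean`)

§SCertificatesB — D′₃ = `z³ + u·t³·w³` (char 3): the singular run FIRES at level 0 (`Dm_singNow_reading`: `Sing(Σ_red) = L` exactly) and
TERMINATES at s-height 2 (`Dm_sDecided_certificate`: every chart of every blow-up, by the LANDED g29 mirror / memory certificates read
as the singular run).  File 5/6 `DeltaCutSingCertificates` carries §SCertificatesA (T₃, the F-ss² inhabitant).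
The module docstring of `DeltaCutSing` (file 1/6) carries the node's summary (the law, the letters, the cells, the honest ceiling and
the sources); `NODE-g30.md` (HOME) is the record.  Same namespace `…Theorems.DeltaCutClasses`, declarations verbatim from the lens
file. [new] [folklore]
-/

noncomputable section

open CategoryTheory CategoryTheory.Limits AlgebraicGeometry TopologicalSpace IsLocalRing
open Literature.AlgebraicGeometry.Resolution

universe u

namespace Summit.ResolutionOfSingularities.ResolutionOfSingularities.Theorems.DeltaCutClasses

open Summit.ResolutionOfSingularities.ResolutionOfSingularities.Theorems.TwistCutClasses
open Summit.ResolutionOfSingularities.ResolutionOfSingularities.Theorems.LightCutClasses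

section SCertificatesB

open MvPolynomial
variable {K : Type*} [Field K]

/-! #### §B — D′₃ = `z³ + u·t³·w³` (char 3): the singular run FIRES at level 0 and TERMINATES at s-height 2 -/

/-- **D′ — THE FIRING READING at level `0` (`SingNow`): `Sing(Σ_red) = L = V(z,t,w)` EXACTLY.**  `Σ = P_t ∪ P_w = V(z, t·w)` is
a complete intersection with `t·w ∈ (t,w)²`: SINGULAR at every point of the crossing line `L` ((R″); first conjunct); and
`(z, w·t) ⊆ J ⊆ (z,t)`, `(z, t·w) ⊆ J ⊆ (z,w)` (`J = 𝓘(P_t) ∩ 𝓘(P_w)`): on `D(w)` resp. `D(t)` — off `L` — `Σ` is a coordinate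
PLANE, REGULAR (R).  With `Dm_crossing_line` (`𝓘(P_t) + 𝓘(P_w) = (z,t,w)`, `u ∉`): the reduced closure of `Sing(Σ_red)` is the
coordinate LINE `L` — REGULAR (R) and NONEMPTY: `SingRegular` HOLDS, and with `Dm_gFrozen_certificate` (R) the level is
`SingFrozen`: THE SINGULAR HOP FIRES at s-height `0`. [new; elementary] [folklore] -/
theorem Dm_singNow_reading :
    (X 1 * X 3 : MvPolynomial (Fin 4) K) ∈ (Ideal.span {(X 1 : MvPolynomial (Fin 4) K), X 3}) ^ 2 ∧
    (Ideal.span {(X 0 : MvPolynomial (Fin 4) K), X 3 * X 1} ≤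
        Ideal.span {(X 0 : MvPolynomial (Fin 4) K), X 1} ⊓ Ideal.span {(X 0 : MvPolynomial (Fin 4) K), X 3} ∧
      Ideal.span {(X 0 : MvPolynomial (Fin 4) K), X 1} ⊓ Ideal.span {(X 0 : MvPolynomial (Fin 4) K), X 3} ≤
        Ideal.span {(X 0 : MvPolynomial (Fin 4) K), X 1}) ∧
    (Ideal.span {(X 0 : MvPolynomial (Fin 4) K), X 1 * X 3} ≤
        Ideal.span {(X 0 : MvPolynomial (Fin 4) K), X 1} ⊓ Ideal.span {(X 0 : MvPolynomial (Fin 4) K), X 3} ∧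
      Ideal.span {(X 0 : MvPolynomial (Fin 4) K), X 1} ⊓ Ideal.span {(X 0 : MvPolynomial (Fin 4) K), X 3} ≤
        Ideal.span {(X 0 : MvPolynomial (Fin 4) K), X 3}) ∧
    (Ideal.span {(X 0 : MvPolynomial (Fin 4) K), X 1} ⊔ Ideal.span {(X 0 : MvPolynomial (Fin 4) K), X 3} =
        Ideal.span {(X 0 : MvPolynomial (Fin 4) K), X 1, X 3} ∧
      (X 2 : MvPolynomial (Fin 4) K) ∉ Ideal.span {(X 0 : MvPolynomial (Fin 4) K), X 1, X 3}) := by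
  have a0 : (X 0 : MvPolynomial (Fin 4) K) ∈ Ideal.span {(X 0 : MvPolynomial (Fin 4) K), X 1} := Ideal.subset_span (by simp)
  have a1 : (X 1 : MvPolynomial (Fin 4) K) ∈ Ideal.span {(X 0 : MvPolynomial (Fin 4) K), X 1} := Ideal.subset_span (by simp)
  have b0 : (X 0 : MvPolynomial (Fin 4) K) ∈ Ideal.span {(X 0 : MvPolynomial (Fin 4) K), X 3} := Ideal.subset_span (by simp)
  have b3 : (X 3 : MvPolynomial (Fin 4) K) ∈ Ideal.span {(X 0 : MvPolynomial (Fin 4) K), X 3} := Ideal.subset_span (by simp)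
  have p1 : (X 1 : MvPolynomial (Fin 4) K) ∈ Ideal.span {(X 1 : MvPolynomial (Fin 4) K), X 3} := Ideal.subset_span (by simp)
  have p3 : (X 3 : MvPolynomial (Fin 4) K) ∈ Ideal.span {(X 1 : MvPolynomial (Fin 4) K), X 3} := Ideal.subset_span (by simp)
  have hz : (X 0 : MvPolynomial (Fin 4) K) ∈
      Ideal.span {(X 0 : MvPolynomial (Fin 4) K), X 1} ⊓ Ideal.span {(X 0 : MvPolynomial (Fin 4) K), X 3} :=
    Ideal.mem_inf.2 ⟨a0, b0⟩
  have hJ : ∀ m : MvPolynomial (Fin 4) K, m = X 1 * X 3 →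
      m ∈ Ideal.span {(X 0 : MvPolynomial (Fin 4) K), X 1} ⊓ Ideal.span {(X 0 : MvPolynomial (Fin 4) K), X 3} := by
    rintro m rfl
    exact Ideal.mem_inf.2 ⟨Ideal.mul_mem_right _ _ a1, Ideal.mul_mem_left _ _ b3⟩
  have spanle : ∀ m : MvPolynomial (Fin 4) K, m = X 1 * X 3 →
      Ideal.span {(X 0 : MvPolynomial (Fin 4) K), m} ≤
        Ideal.span {(X 0 : MvPolynomial (Fin 4) K), X 1} ⊓ Ideal.span {(X 0 : MvPolynomial (Fin 4) K), X 3} := by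
    intro m hm
    subst hm
    refine Ideal.span_le.2 ?_
    rintro g hg
    simp only [Set.mem_insert_iff, Set.mem_singleton_iff] at hg
    rcases hg with rfl | rfl
    · exact hz
    · exact hJ _ rfl
  refine ⟨?_, ⟨spanle _ (by ring), inf_le_left⟩, ⟨spanle _ rfl, inf_le_right⟩, Dm_crossing_line⟩
  rw [pow_two]; exact Ideal.mul_mem_mul p1 p3

/-- **D′₃ — THE S-DECIDED CERTIFICATE (`STerminates 3 ⟨(𝔸⁴, (D′₃)), none⟩` at s-height `2`; THE ELIMINATED SUB-KIND «F-surf-sing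
WITH REGULAR Sing-closure» IS INHABITED AND DECIDED — every affine chart of every blow-up, ALL LANDED, read as the singular
run).**  Level 0 FIRES (`Dm_singNow_reading` with `Dm_gFrozen_certificate`); HOP 1 = STEP 1, the blow-up of `L` — charts `t`,
`w`: D′₃ again (exceptional plane + OLD plane), chart `z`: no top — then STEP 2, the blow-up of the strict transform `P̃_t ⊔
P̃_w` of the OLD surface part (in chart `t`: `V(z,w)`, a coordinate plane; chart `w`: its mirror; the two pieces are disjoint:
`OldSurfRegular` (R)) — chart `w`: `F₂ = z³ + u·t³`, chart `z`: no top; LEVEL 1: top `= V(z,t)` `=` closure bad₁, a REGULAR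
plane — `SepActive`, so HOP 2 is g26's separating hop (`sHop = gHop = refHop = sepHop` there): blow up `V(z,t)` — chart `t`:
`z³ + u` (order `≤ 1`), chart `z`: no top; no old top component is left (its step 2 has empty centre) —; LEVEL 2: NO top point
in any chart: `BadEmpty` — `STerminates` at s-height `2`, moving prefix = (fire, separate). [new] [folklore] -/
theorem Dm_sDecided_certificate [CharP K 3] :
    -- level 0 fires: Sing(Σ_red) = L (singular along L, regular off L, L a coordinate line)
    ((X 1 * X 3 : MvPolynomial (Fin 4) K) ∈ (Ideal.span {(X 1 : MvPolynomial (Fin 4) K), X 3}) ^ 2 ∧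
      (Ideal.span {(X 0 : MvPolynomial (Fin 4) K), X 3 * X 1} ≤
          Ideal.span {(X 0 : MvPolynomial (Fin 4) K), X 1} ⊓ Ideal.span {(X 0 : MvPolynomial (Fin 4) K), X 3} ∧
        Ideal.span {(X 0 : MvPolynomial (Fin 4) K), X 1} ⊓ Ideal.span {(X 0 : MvPolynomial (Fin 4) K), X 3} ≤
          Ideal.span {(X 0 : MvPolynomial (Fin 4) K), X 1}) ∧
      (Ideal.span {(X 0 : MvPolynomial (Fin 4) K), X 1} ⊔ Ideal.span {(X 0 : MvPolynomial (Fin 4) K), X 3} =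
          Ideal.span {(X 0 : MvPolynomial (Fin 4) K), X 1, X 3} ∧
        (X 2 : MvPolynomial (Fin 4) K) ∉ Ideal.span {(X 0 : MvPolynomial (Fin 4) K), X 1, X 3})) ∧
    -- hop 1, step 1: the three Rees charts of the blow-up of L
    (aeval (linChartSubst (K := K) {0, 1, 3} 1) (mirrorF (K := K) 3) = X 1 ^ 3 * mirrorF 3 ∧
      aeval (linChartSubst (K := K) {0, 1, 3} 3) (mirrorF (K := K) 3) = X 3 ^ 3 * mirrorF 3 ∧
      aeval (linChartSubst (K := K) {0, 1, 3} 0) (mirrorF (K := K) 3) = X 0 ^ 3 * (1 + X 2 * X 1 ^ 3 * X 3 ^ 3 * X 0 ^ 3)) ∧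
    -- hop 1, step 2: the blow-up of the OLD plane V(z,w) of chart t (chart w of step 1 is its mirror)
    (aeval (linChartSubst (K := K) {0, 3} 3) (mirrorF (K := K) 3) = X 3 ^ 3 * (X 0 ^ 3 + X 2 * X 1 ^ 3) ∧
      aeval (linChartSubst (K := K) {0, 3} 0) (mirrorF (K := K) 3) = X 0 ^ 3 * (1 + X 2 * X 1 ^ 3 * X 3 ^ 3)) ∧
    -- level 1: top = the REGULAR plane V(z,t), all bad (SepActive)
    (∀ (𝔮 : Ideal (MvPolynomial (Fin 4) K)) [𝔮.IsPrime], ∀ s ∉ 𝔮,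
        s * (X 0 ^ 3 + X 2 * X 1 ^ 3 : MvPolynomial (Fin 4) K) ∈ 𝔮 ^ 3 →
          (X 0 : MvPolynomial (Fin 4) K) ∈ 𝔮 ∧ (X 1 : MvPolynomial (Fin 4) K) ∈ 𝔮) ∧
    ((X 0 ^ 3 + X 2 * X 1 ^ 3 : MvPolynomial (Fin 4) K) ∈ (Ideal.span {(X 0 : MvPolynomial (Fin 4) K), X 1}) ^ 3 ∧
      Ideal.span {(X 0 ^ 3 + X 2 * X 1 ^ 3 : MvPolynomial (Fin 4) K), X 1 ^ 3} ≤
        (Ideal.span {(X 0 : MvPolynomial (Fin 4) K), X 1}) ^ 3) ∧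
    -- hop 2 = the separating hop: the two Rees charts of the blow-up of V(z,t)
    (aeval (linChartSubst (K := K) {0, 1} 1) (X 0 ^ 3 + X 2 * X 1 ^ 3 : MvPolynomial (Fin 4) K) = X 1 ^ 3 * (X 0 ^ 3 + X 2) ∧
      aeval (linChartSubst (K := K) {0, 1} 0) (X 0 ^ 3 + X 2 * X 1 ^ 3 : MvPolynomial (Fin 4) K) =
        X 0 ^ 3 * (1 + X 2 * X 1 ^ 3)) ∧
    -- no top point in the unit-form charts of hop 1 and ANYWHERE at level 2: BadEmpty at s-height 2
    (∀ (𝔮 : Ideal (MvPolynomial (Fin 4) K)) [𝔮.IsPrime], ∀ s ∉ 𝔮,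
        (s * (1 + X 2 * X 1 ^ 3 * X 3 ^ 3 * X 0 ^ 3 : MvPolynomial (Fin 4) K) ∈ 𝔮 ^ 3 → False) ∧
        (s * (1 + X 2 * X 1 ^ 3 * X 3 ^ 3 : MvPolynomial (Fin 4) K) ∈ 𝔮 ^ 3 → False) ∧
        (s * (1 + X 2 * X 1 ^ 3 : MvPolynomial (Fin 4) K) ∈ 𝔮 ^ 3 → False) ∧
        (s * (X 0 ^ 3 + X 2 : MvPolynomial (Fin 4) K) ∈ 𝔮 ^ 3 → False)) :=
  ⟨⟨Dm_singNow_reading.1, Dm_singNow_reading.2.1, Dm_singNow_reading.2.2.2⟩,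
    ⟨mirrorF_lineChart_t 3, mirrorF_lineChart_w 3, mirrorF_lineChart_z 3⟩,
    ⟨mirrorF_oldPlaneChart_w 3, mirrorF_oldPlaneChart_z 3⟩, fun 𝔮 _ _ hs h => planeF_top 𝔮 hs h,
    ⟨(planeF_plane_bad (K := K)).1, (planeF_plane_bad (K := K)).2.2.2⟩,
    ⟨planeF_newPlaneChart_t 3, planeF_newPlaneChart_z 3⟩,
    fun 𝔮 _ _ hs => ⟨fun h => Dm_lineChart_z_noTop 𝔮 hs h, Dm_memory_noTop 𝔮 hs⟩⟩

end SCertificatesB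

end Summit.ResolutionOfSingularities.ResolutionOfSingularities.Theorems.DeltaCutClasses
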